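import Summits.BirchSwinnertonDyer.BirchSwinnertonDyer.Theorems.ErratumRoadFiveEulerHalfGenusFamilyPackage
import Summits.BirchSwinnertonDyer.BirchSwinnertonDyer.Theorems.ErratumRoadFiveEulerHalfGenusFamilyLocalOrders
import Summits.BirchSwinnertonDyer.BirchSwinnertonDyer.Theorems.ErratumRoadFiveEulerHalfGenusFamilyTransverse
import Summits.BirchSwinnertonDyer.BirchSwinnertonDyer.Theorems.ErratumRoadFiveEulerHalfGenusClassDataLocal
import HarnessLib

/-!
# ErratumRoadFive ∕ EulerHalf ∕ genus line — (b2b-κ) THE CLOSER: `GenusLine.GenusClassDataSupply` FROM THE PRINTED FACTS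
# (helper, `--supports 23444`; VARIANT-N: the registered stub `stub_genusClassDataSupply` closes once the pen's cite-only
# re-cut hands it the four printed inputs)

Cell bsd-stepL, prover seat `bsd-stepL-imc-p1` g42; plan `HOME/imc-p1/g42/B2BK-ASSEMBLY-PLAN-imc-p1-g42.md` §8 (L3); line owner
bsd-idea-9 g27 (`…GenusClassDataFrame` p731063, `…GenusClassDataLocal` p731685) supplied clauses (1)(4)(5) in the package currency.

WHAT.  `genusClassDataSupply_of_printedFacts (hG1) (hNek) (hP53) (hmodP) : GenusLine.GenusClassDataSupply` — the class-data child
(b2b-κ) of crux 23444's genus line, for EVERY served frame, from the four cite-level printed inputs (G1) Gross–Darmon rationality of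
CM points, (B5) Nekovář's congruence, (B3) Gross Prop. 5.3 pinned, and modularity (`nonempty_modularParametrizationData`, used only to
read Gross depths).  Assembly over a core vertex `c` (level `k`, `m(c) = m_∞ < k ≤ M(c) − m_∞`):
labels `⟨yK, ys, ε₀, hL, hid⟩ := genusLabelsSupplyOddAt_of_printedFacts` (p729065; labels OFF `2N_W`, no `d8`) ▸ the coherent family
package `D` on the divisors of `c` and, per Kolyvagin prime `ℓ ∤ c` of index `≥ k`, `D′_ℓ` on the divisors of `cℓ` (p730456) ▸
`κ := c_k(D c)`, `κ_ℓ := c_k(D′_ℓ (cℓ))`, `ε := ε₀ (−1)^{ω(c)}` ▸ clause (1) `kolyvaginClass_mem_modifiedSelmerGroup_of_frameProfile` (g27),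
(2) `addOrderOf_kolyvaginClass_of_genusDepth` (exact genus depth `m_∞` read off `mdiv`/`m`; p730456 + adapter A p730113), (3) package
signs (`ω(cℓ) = ω(c) + 1`), (4) `localization_kolyvaginClass_mem_kummer_of_frameProfile` (g27), (5)
`localization_kolyvaginClass_mem_stringentFamily_of_frameProfile` (g27), (6) `localization_kolyvaginClass_mem_transverse_of_frameProfile`
(p731401), (7) `addOrderOf_localization_kolyvaginClass_eq_of_frameProfile` (p730852).

HONEST FRAMING: conditional on the four named printed facts (hypotheses); the registered stub is NOT discharged by this file as stated
(it is the pen's VARIANT-N re-cut that feeds it); no crux and no summit statement is proved; BSD is proved for no curve.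
[cite: Jetchev2008, §3.1 item 7, Prop. 4.7, Prop. 4.9, Thm. 5.2] [cite: GrossLMS1991, Prop. 3.7, Prop. 5.4, Prop. 6.2 (1)]
[cite: McCallumLMS1991, Lemma 4.1, Prop. 4.4, Cor. 4.5] presearch: in-tree only; no new literature.
-/

set_option autoImplicit false
-- D-0017: single-problem summit, so `Summit.BirchSwinnertonDyer.BirchSwinnertonDyer.…` repeats a namespace BY DESIGN.
set_option linter.dupNamespace false

noncomputable section

open scoped Classical
open WeierstrassCurve NumberField Field IsDedekindDomain Literature.NumberTheory.EllipticCurves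
  Literature.NumberTheory.EllipticCurves.ModularForms Literature.NumberTheory.GaloisRepresentations
  Literature.NumberTheory.GaloisRepresentations.DiscreteGaloisModule Literature.NumberTheory.EllipticCurves.KolyvaginCocycle
  Literature.NumberTheory.EllipticCurves.Jetchev2008
  Summit.BirchSwinnertonDyer.Rank1Residual Summit.BirchSwinnertonDyer.Rank1Residual.X11b
  Summit.BirchSwinnertonDyer.Rank1Residual.JET Summit.BirchSwinnertonDyer.Rank1Residual.JET.SelmerVocabulary
  Summit.BirchSwinnertonDyer.BirchSwinnertonDyer.Theorems.GenusKolyvagin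

namespace Summit.BirchSwinnertonDyer.BirchSwinnertonDyer.Theorems.GenusLine

/-! ## §1 Bookkeeping lemmas -/

/-- A Zhang–Kolyvagin level on a served frame is prime to `N_{E′}` (its primes are odd, prime to `N_W` and to `d_K ⊇ d₁`; a twist by
`d₁` keeps good reduction at such primes). [cite: SilvermanAEC2009, X.§2] -/
theorem coprime_conductorNorm_E'_of_kolyvaginLevel {W A : WeierstrassCurve ℚ} [W.IsElliptic] [W.IsGloballyMinimal] [A.IsElliptic]
    {p q : ℕ} [Fact p.Prime] [Fact q.Prime] {K : Type} [Field K] [NumberField K]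
    (S : GenusHeegnerSettingRC W A p q K) (hprof : FrameProfile W A p q K) {c : ℕ} (hc : Squarefree c)
    (hKol : ∀ ℓ ∈ c.primeFactors, Zhang2014.IsKolyvaginPrime (W.conductorNorm ℤ) W K p ℓ) :
    haveI := S.nz; c.Coprime (S.E'.conductorNorm ℤ) := by
  haveI := S.ell; haveI := S.nz
  refine (ModularAuxNorm.coprime_of_forall_primeFactors_not_dvd hc.ne_zero fun r hr hrN ↦ ?_).symm
  have hr := hKol r hr
  haveI : Fact r.Prime := ⟨hr.1⟩
  have hr2 : r ≠ 2 := ne_two_of_isKolyvaginPrime hr (Fact.out : p.Prime) (p_ne_three_of_frameProfile hprof)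
  have hrd : ¬ (r : ℤ) ∣ S.d₁ := fun h ↦ hr.2.2.1 (h.trans (S.hd ▸ dvd_mul_right S.d₁ S.d₂))
  have hgoodW : W.HasGoodReductionAtPrime r :=
    not_not.mp (mt (W.dvd_conductorNorm_iff_not_hasGoodReductionAtPrime r).mpr hr.2.1)
  exact (S.E'.dvd_conductorNorm_iff_not_hasGoodReductionAtPrime r).mp hrN
    (hasGoodReductionAtPrime_of_twist_presentation W S.E' S.hE' hr2 hrd hgoodW)

/-- `ω(cℓ) = ω(c) + 1` for a prime `ℓ ∤ c`. [folklore] -/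
theorem card_primeFactors_mul_prime {c ℓ : ℕ} (hc : c ≠ 0) (hℓ : ℓ.Prime) (hℓc : ℓ ∉ c.primeFactors) :
    (c * ℓ).primeFactors.card = c.primeFactors.card + 1 := by
  rw [Nat.primeFactors_mul hc hℓ.ne_zero, hℓ.primeFactors, Finset.card_union_of_disjoint
    (Finset.disjoint_singleton_right.mpr hℓc), Finset.card_singleton]

/-! ## §2 The closer -/

/-- **(b2b-κ) `GenusClassDataSupply` FROM THE PRINTED FACTS** — see the module docstring. [cite: Jetchev2008, §3.1 item 7, Prop. 4.7, Prop. 4.9]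
[cite: GrossLMS1991, Prop. 5.4, Prop. 6.2 (1)] [cite: McCallumLMS1991, Lemma 4.1, Prop. 4.4, Cor. 4.5] -/
theorem genusClassDataSupply_of_printedFacts
    (hG1 : ∀ (N : ℕ) [NeZero N] (W : WeierstrassCurve ℚ) (K : Type) [Field K] [NumberField K],
      phi_heegnerPointOfConductor_mem_range_map_ringClassField_birch N W K)
    (hNek : Nekovar2007.cmPoint_frobeniusCongruence)
    (hP53 : ∀ (N : ℕ) [NeZero N] (W : WeierstrassCurve ℚ) (K : Type) [Field K] [NumberField K],
      GrossLMS1991.prop53_conj_pinned_birch N W K)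
    (hmodP : nonempty_modularParametrizationData) : GenusClassDataSupply := by
  intro W _ _ A _ _ p q _ _ K _ _ S hprof hidx hsha hPinf
  haveI := S.ell; haveI := S.min; haveI := S.nz; haveI := S.nf
  intro _ τ hτ mdiv m hmdiv hm mInf hmInf hMin k c hk hcore hmc hkM hik _ _ hn
  have hp : p.Prime := Fact.out
  haveI : NeZero (W.conductorNorm ℤ) := ⟨(WeierstrassCurve.conductorNorm_pos_holds _).ne'⟩
  obtain ⟨DtW⟩ := hmodP W
  -- the labelled family (labels off `2N_W`; printed facts G1, B5, B3)
  obtain ⟨yK, ys, ε₀, hL, hid⟩ := genusLabelsSupplyOddAt_of_printedFacts hG1 hNek hP53 W A p q K S hprof.quad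
  -- the core vertex `c`: square-free Zhang–Kolyvagin, genuine, `k ≤ M(c)`, exact genus depth `m_∞`
  have hc0 : c.1 ≠ 0 := c.2.1.ne_zero
  have hcE := coprime_conductorNorm_E'_of_kolyvaginLevel S hprof c.2.1 c.2.2
  have hkc : (k : ℕ∞) ≤ Zhang2014.levelIndex W p c.1 := le_trans le_self_add hkM
  have hmdivc : mdiv c = (mInf : ℕ∞) := by
    have h := hm c
    rw [hmc] at h
    by_cases hlt : mdiv c < Zhang2014.levelIndex W p c.1
    · rw [if_pos hlt] at h; exact h.symm
    · rw [if_neg hlt] at h; exact absurd h (ENat.coe_ne_top mInf)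
  have hdiv := (hmdiv c mInf).mp (by rw [hmdivc])
  have hndiv : ¬ ∀ δ : GenusKolyvaginDatum S.E' K S.ιc S.Dt S.β S.d₁ c.1,
      ∃ z : (W.baseChange (ringClassField K S.ιc c.1 : Type)).toAffine.Point,
        ((p ^ (mInf + 1) : ℕ) : ℤ) • z = genusFamilyPoint W S.E' S.D S.C₂ S.hWd K S.ιc δ := fun h ↦ by
    have h' := (hmdiv c (mInf + 1)).mpr h
    rw [hmdivc] at h'
    exact absurd (ENat.coe_le_coe.mp h') (by omega)
  -- the coherent family package at level `c`
  obtain ⟨D, hDy, hB4d, hB3d, hA, hP, hsign⟩ := exists_familyPackage S hprof DtW hL hk c.2.1 c.2.2 hkc τ hτ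
  -- per Kolyvagin prime `ℓ ∤ c` of index `≥ k`: the level `cℓ` and its package
  have hcℓ : ∀ (ℓ : ℕ), Zhang2014.IsKolyvaginPrime (W.conductorNorm ℤ) W K p ℓ → ℓ ∉ c.1.primeFactors →
      Squarefree (c.1 * ℓ) := fun ℓ h1 h3 ↦
    (Nat.squarefree_mul (Nat.Coprime.symm ((Nat.Prime.coprime_iff_not_dvd h1.1).mpr fun h ↦
      h3 (Nat.mem_primeFactors.mpr ⟨h1.1, h, hc0⟩)))).mpr ⟨c.2.1, h1.1.prime.squarefree⟩
  have hKolcℓ : ∀ (ℓ : ℕ), Zhang2014.IsKolyvaginPrime (W.conductorNorm ℤ) W K p ℓ →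
      ∀ r ∈ (c.1 * ℓ).primeFactors, Zhang2014.IsKolyvaginPrime (W.conductorNorm ℤ) W K p r := by
    intro ℓ h1 r hr
    rw [Nat.primeFactors_mul hc0 h1.1.ne_zero, Finset.mem_union] at hr
    rcases hr with h | h
    · exact c.2.2 r h
    · rw [h1.1.primeFactors, Finset.mem_singleton] at h
      subst h
      exact h1
  have hkcℓ : ∀ (ℓ : ℕ), Zhang2014.IsKolyvaginPrime (W.conductorNorm ℤ) W K p ℓ → k ≤ Zhang2014.kolyvaginIndex W p ℓ →
      (k : ℕ∞) ≤ Zhang2014.levelIndex W p (c.1 * ℓ) := fun ℓ h1 h2 ↦ natCast_le_levelIndex_mul hc0 h1.1 hkc h2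
  have hpkg : ∀ (ℓ : ℕ) (h1 : Zhang2014.IsKolyvaginPrime (W.conductorNorm ℤ) W K p ℓ)
      (h2 : k ≤ Zhang2014.kolyvaginIndex W p ℓ) (h3 : ℓ ∉ c.1.primeFactors),
      ∃ D' : (m' : ℕ) → m' ∣ c.1 * ℓ → KolyvaginFamilyData W K S.ιc m',
        (∀ (m' : ℕ) (hm' : m' ∣ c.1 * ℓ), (D' m' hm').y = ys m') ∧
        (∀ (m' : ℕ) (hm' : m' ∣ c.1 * ℓ), ∀ (l : ℕ) (hl : l ∈ m'.primeFactors)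
          (hle : ringClassField K S.ιc (m' / l) ≤ ringClassField K S.ιc m'),
          ∑ i ∈ Finset.range (l + 1), pointGalHom W (ringClassField K S.ιc m') ((D' m' hm').σ l ^ i) (D' m' hm').y =
            W.frobeniusTrace l • WeierstrassCurve.Affine.Point.map (W' := W)
              ((RingClassField.inclusion S.ιc hle).restrictScalars ℚ)
              (D' (m' / l) ((Nat.div_dvd_of_dvd (Nat.dvd_of_mem_primeFactors hl)).trans hm')).y) ∧
        (∀ (m' : ℕ) (hm' : m' ∣ c.1 * ℓ) (M : ℕ),
          IsAdmissible (absoluteGaloisGroup K) (D' m' hm').pointsSubgroup ((p ^ M : ℕ) : ℤ)) ∧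
        (∀ (m' : ℕ) (hm' : m' ∣ c.1 * ℓ),
          conjAct W τ ((p ^ k : ℕ) : ℤ) ((D' m' hm').kolyvaginClass (Fact.out : p.Prime) k) =
            (ε₀ * (-1) ^ m'.primeFactors.card) • (D' m' hm').kolyvaginClass (Fact.out : p.Prime) k) := by
    intro ℓ h1 h2 h3
    obtain ⟨D', hD'y, hB4d', -, hA', -, hsign'⟩ :=
      exists_familyPackage S hprof DtW hL hk (hcℓ ℓ h1 h3) (hKolcℓ ℓ h1) (hkcℓ ℓ h1 h2) τ hτ
    exact ⟨D', hD'y, hB4d', hA', hsign'⟩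
  choose D' hD'y hB4d' hA' hsign' using hpkg
  -- the sign, the classes
  have hε₀ : ε₀ = 1 ∨ ε₀ = -1 := hL.1
  set ε : ℤ := ε₀ * (-1) ^ c.1.primeFactors.card with hεdef
  have hε : ε = 1 ∨ ε = -1 := by
    rcases hε₀ with h | h <;> rcases neg_one_pow_eq_or ℤ c.1.primeFactors.card with h' | h' <;> simp [hεdef, h, h']
  obtain ⟨hord, hne⟩ := addOrderOf_kolyvaginClass_of_genusDepth hG1 S hprof DtW hL hid hk c.2.1 hcE c.2.2 hkc hik hdiv hndiv
    D hDy (hA c.1 dvd_rfl k) (hP c.1 dvd_rfl)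
  refine ⟨ε, hε, (D c.1 dvd_rfl).kolyvaginClass hp k,
    fun ℓ h1 h2 h3 ↦ (D' ℓ h1 h2 h3 (c.1 * ℓ) dvd_rfl).kolyvaginClass hp k, ?_, ?_, hne, hord, ?_, ?_, ?_, ?_, ?_⟩
  · -- (1) `κ ∈ H_{𝓕(c)}`
    exact kolyvaginClass_mem_modifiedSelmerGroup_of_frameProfile W A p q K S hprof hG1 DtW hid hk hn c.2.1 c.2.2 hkc D hDy
      hB4d hA
  · -- (2) `τ κ = ε κ`
    exact hsign c.1 dvd_rfl
  · -- (3) `τ κ_ℓ = −ε κ_ℓ`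
    intro ℓ h1 h2 h3
    rw [hsign' ℓ h1 h2 h3 (c.1 * ℓ) dvd_rfl, card_primeFactors_mul_prime hc0 h1.1 h3, pow_succ, hεdef]
    congr 1
    ring
  · -- (4) Kummer off `cℓ`
    intro ℓ h1 h2 h3 w hw
    exact localization_kolyvaginClass_mem_kummer_of_frameProfile W A p q K S hprof hG1 DtW hid hk hn (hcℓ ℓ h1 h3)
      (hKolcℓ ℓ h1) (hkcℓ ℓ h1 h2) (D' ℓ h1 h2 h3) (hD'y ℓ h1 h2 h3) (hB4d' ℓ h1 h2 h3) (hA' ℓ h1 h2 h3) dvd_rfl w hw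
  · -- (5) stringent at the places over `p`
    intro ℓ h1 h2 h3 q' hq'
    exact localization_kolyvaginClass_mem_stringentFamily_of_frameProfile W A p q K S hprof hG1 DtW hid hk hn (hcℓ ℓ h1 h3)
      (hKolcℓ ℓ h1) (hkcℓ ℓ h1 h2) (D' ℓ h1 h2 h3) (hD'y ℓ h1 h2 h3) (hB4d' ℓ h1 h2 h3) (hA' ℓ h1 h2 h3) dvd_rfl q' hq'
  · -- (6) transverse at the places dividing `c`
    intro ℓ h1 h2 h3 w _
    exact localization_kolyvaginClass_mem_transverse_of_frameProfile S hprof hk (hcℓ ℓ h1 h3) (hKolcℓ ℓ h1) (hkcℓ ℓ h1 h2)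
      (D' ℓ h1 h2 h3 (c.1 * ℓ) dvd_rfl) w
  · -- (7) `ord loc_λ κ_ℓ = ord loc_λ κ`
    intro ℓ h1 h2 h3 v hv
    exact addOrderOf_localization_kolyvaginClass_eq_of_frameProfile S hprof DtW hL hk c.2.1 c.2.2 hkc h1 h2 h3
      (D c.1 dvd_rfl) (D' ℓ h1 h2 h3 (c.1 * ℓ) dvd_rfl) (hDy c.1 dvd_rfl) (hD'y ℓ h1 h2 h3 (c.1 * ℓ) dvd_rfl) v hv

end Summit.BirchSwinnertonDyer.BirchSwinnertonDyer.Theorems.GenusLine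

end
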